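import Literature.Analysis.Complex.PolyaBesselKernel
import Literature.NumberTheory.Automorphic.MaassFormWhittakerModes
import HarnessLib

/-!
# The order recurrences of Pólya's `G₀(x, w) = 2 K_{iw}(x)`:
# `G₀(x, w ± i) = G₁(x, w) ∓ (iw/x) G₀(x, w)`

Topic `Analysis/Complex`; namespace `Literature.Analysis.Complex.Polya1926`. Theorems only (no
definition, no named fact). The classical recurrences of the modified Bessel functions
`K_{ν-1}(x) = -K_ν'(x) - (ν/x) K_ν(x)`, `K_{ν+1}(x) = -K_ν'(x) + (ν/x) K_ν(x)` (Watson, §3.71 (3), (4)),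
for Pólya's trigonometric integrals `G_n(x, w) = ∫ cosh(t)^n e^{-x cosh t} e^{iwt} dt`
(`G₀(x, w) = 2 K_{iw}(x)`, `G₁ = -∂_x G₀`; tree `PolyaBesselKernel`): a shift of the order `iw` by
`∓1` is a shift of the Fourier variable `w` by `± i`, i.e. the factor `e^{∓t}` in the integrand, so

* `polyaG_zero_add_I_add_polyaG_zero_sub_I` — `G₀(x, w+i) + G₀(x, w-i) = 2 G₁(x, w)`
  (`e^{-t} + e^{t} = 2 cosh t`);
* `polyaG_zero_add_I_sub_polyaG_zero_sub_I` — `G₀(x, w+i) - G₀(x, w-i) = -(2iw/x) G₀(x, w)`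
  (`e^{-t} - e^{t} = -2 sinh t`, and `sinh t · e^{-x cosh t} = -x⁻¹ ∂_t e^{-x cosh t}`, integration by
  parts);
* `polyaG_zero_sub_I`, `polyaG_zero_add_I` — the solved forms `G₀(x, w ∓ i) = G₁(x, w) ± (iw/x) G₀(x, w)`;
* `besselMode_sub_I`, `besselMode_add_I` — the same for the Bessel mode
  `besselMode κ w y = √y G₀(κy, w)` of `MaassFormWhittakerModes`:
  `besselMode κ (w ∓ i) y = ((1/2 ± iw)/(κy)) besselMode κ w y - κ⁻¹ besselMode₁ κ w y`.

These are the order-shifting identities needed for the `SU(2)`-strings of `K`-types in the archimedean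
Hecke theory of `GL₂(ℂ)` (`NumberTheory/Automorphic/ArchKirillov…Complex…`).

## References

* G. N. Watson, *A Treatise on the Theory of Bessel Functions*, 2nd ed. (1944), §3.71, (3)–(4)
  and §6.22 (8) (the integral `K_ν(x) = ∫₀^∞ e^{-x cosh t} cosh(νt) dt`). [folklore]
-/

noncomputable section

open Complex MeasureTheory Filter Metric Set Topology

namespace Literature.Analysis.Complex

namespace Polya1926

/-- `e^{i(w ± i)t} = e^{iwt} e^{∓t}`. [folklore] -/
theorem cexp_I_mul_add_I_mul (w : ℂ) (t : ℝ) :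
    Complex.exp (I * (w + I) * t) = Complex.exp (I * w * t) * Complex.exp (-(t : ℂ)) ∧
    Complex.exp (I * (w - I) * t) = Complex.exp (I * w * t) * Complex.exp (t : ℂ) := by
  refine ⟨?_, ?_⟩ <;> rw [← Complex.exp_add] <;> congr 1 <;> ring_nf <;> rw [Complex.I_sq] <;> ring

/-- **`G₀(x, w+i) + G₀(x, w-i) = 2 G₁(x, w)`** (`x > 0`). [folklore] -/
theorem polyaG_zero_add_I_add_polyaG_zero_sub_I {x : ℝ} (hx : 0 < x) (w : ℂ) :
    polyaG 0 x (w + I) + polyaG 0 x (w - I) = 2 * polyaG 1 x w := by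
  rw [polyaG_eq, polyaG_eq, polyaG_eq, ← integral_add (integrable_polyaKernel_mul_cexp hx 0 _)
    (integrable_polyaKernel_mul_cexp hx 0 _), ← integral_const_mul]
  refine integral_congr_ae (Eventually.of_forall fun t => ?_)
  show (polyaKernel 0 x t : ℂ) * Complex.exp (I * (w + I) * t) + (polyaKernel 0 x t : ℂ) * Complex.exp (I * (w - I) * t) =
    2 * ((polyaKernel 1 x t : ℂ) * Complex.exp (I * w * t))
  rw [(cexp_I_mul_add_I_mul w t).1, (cexp_I_mul_add_I_mul w t).2, polyaKernel_succ, polyaKernel_zero]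
  have hc : Complex.cosh (t : ℂ) = (Complex.exp (t : ℂ) + Complex.exp (-(t : ℂ))) / 2 := rfl
  push_cast
  rw [hc]
  ring

/-- **`G₀(x, w+i) - G₀(x, w-i) = -(2iw/x) G₀(x, w)`** (`x > 0`): integration by parts against
`∂_t e^{-x cosh t} = -x sinh t e^{-x cosh t}`. [folklore] -/
theorem polyaG_zero_add_I_sub_polyaG_zero_sub_I {x : ℝ} (hx : 0 < x) (w : ℂ) :
    polyaG 0 x (w + I) - polyaG 0 x (w - I) = -(2 * I * w / x) * polyaG 0 x w := by
  have hx0 : (x : ℂ) ≠ 0 := Complex.ofReal_ne_zero.2 hx.ne'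
  set c : ℝ → ℂ := fun t ↦ Complex.exp (I * w * t) with hc
  -- `Ψ(t) = (2/x) k₀(x,t) e^{iwt}`, `Ψ' = -2 sinh t k₀ e^{iwt} + (2iw/x) k₀ e^{iwt}`
  set Ψ : ℝ → ℂ := fun t ↦ (2 / x : ℂ) * ((polyaKernel 0 x t : ℂ) * c t) with hΨ
  set Ψ' : ℝ → ℂ := fun t ↦ -2 * ((Real.sinh t : ℂ) * ((polyaKernel 0 x t : ℂ) * c t)) +
      (2 * I * w / x) * ((polyaKernel 0 x t : ℂ) * c t) with hΨ'
  have hderiv : ∀ t, HasDerivAt Ψ (Ψ' t) t := by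
    intro t
    have h1 := (hasDerivAt_polyaKernel_zero_right x t).ofReal_comp
    have h2 : HasDerivAt c (Complex.exp (I * w * t) * (I * w)) t := by
      have h : HasDerivAt (fun s : ℝ ↦ I * w * (s : ℂ)) (I * w * 1) t := by
        simpa using ((hasDerivAt_id t).ofReal_comp).const_mul (I * w)
      simpa using h.cexp
    have h4 := (h1.mul h2).const_mul (2 / x : ℂ)
    refine h4.congr_deriv ?_
    simp only [hΨ', hc]
    push_cast
    field_simp
  -- integrability
  have hi : ∀ z : ℂ, Integrable fun t ↦ (polyaKernel 0 x t : ℂ) * Complex.exp (I * z * t) := fun z ↦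
    integrable_polyaKernel_mul_cexp hx 0 z
  have hΨi : Integrable Ψ := (hi w).const_mul _
  have hsinh : Integrable fun t ↦ (Real.sinh t : ℂ) * ((polyaKernel 0 x t : ℂ) * c t) := by
    have hmaj := integrable_norm_polyaKernel_mul_exp hx 0 (‖w‖ + 1)
    refine hmaj.mono' (by simp only [hc]; fun_prop) (Eventually.of_forall fun t ↦ ?_)
    simp only [hc]
    rw [norm_mul, norm_mul, norm_polyaKernel, Complex.norm_real, Real.norm_eq_abs]
    have hk := polyaKernel_nonneg 0 x t
    calc |Real.sinh t| * (polyaKernel 0 x t * ‖Complex.exp (I * w * t)‖)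
        ≤ Real.exp |t| * (polyaKernel 0 x t * Real.exp (‖w‖ * |t|)) := by
          gcongr
          · exact abs_sinh_le_exp_abs t
          · exact norm_cexp_I_mul_mul_le w t
      _ = polyaKernel 0 x t * Real.exp ((‖w‖ + 1) * |t|) := by
          rw [add_mul, Real.exp_add, one_mul]; ring
  have hΨ'i : Integrable Ψ' := (hsinh.const_mul _).add ((hi w).const_mul _)
  have h0 := integral_eq_zero_of_hasDerivAt_of_integrable hderiv hΨ'i hΨi
  -- the left side as an integral
  have hL : polyaG 0 x (w + I) - polyaG 0 x (w - I) = -2 * ∫ t, (Real.sinh t : ℂ) * ((polyaKernel 0 x t : ℂ) * c t) := by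
    rw [polyaG_eq, polyaG_eq, ← integral_sub (hi _) (hi _), ← integral_const_mul]
    refine integral_congr_ae (Eventually.of_forall fun t => ?_)
    show (polyaKernel 0 x t : ℂ) * Complex.exp (I * (w + I) * t) - (polyaKernel 0 x t : ℂ) * Complex.exp (I * (w - I) * t) =
      -2 * ((Real.sinh t : ℂ) * ((polyaKernel 0 x t : ℂ) * c t))
    rw [(cexp_I_mul_add_I_mul w t).1, (cexp_I_mul_add_I_mul w t).2]
    have hs : (Real.sinh t : ℂ) = (Complex.exp (t : ℂ) - Complex.exp (-(t : ℂ))) / 2 := by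
      rw [Complex.ofReal_sinh]; rfl
    simp only [hc]
    rw [hs]
    ring
  have h5 : ∫ t, Ψ' t = -2 * (∫ t, (Real.sinh t : ℂ) * ((polyaKernel 0 x t : ℂ) * c t)) +
      (2 * I * w / x) * polyaG 0 x w := by
    simp only [hΨ']
    rw [integral_add (hsinh.const_mul _) ((hi w).const_mul _), integral_const_mul, integral_const_mul, polyaG_eq]
  rw [hL]
  rw [h0] at h5
  linear_combination -h5

/-- **Order lowering**: `G₀(x, w - i) = G₁(x, w) + (iw/x) G₀(x, w)`, i.e.
`K_{ν+1}(x) = -K_ν'(x) + (ν/x) K_ν(x)` for `ν = iw` (`G₀ = 2K_{iw}`, `G₁ = -∂ₓ G₀`). [folklore] -/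
theorem polyaG_zero_sub_I {x : ℝ} (hx : 0 < x) (w : ℂ) :
    polyaG 0 x (w - I) = polyaG 1 x w + (I * w / x) * polyaG 0 x w := by
  have h1 := polyaG_zero_add_I_add_polyaG_zero_sub_I hx w
  have h2 := polyaG_zero_add_I_sub_polyaG_zero_sub_I hx w
  linear_combination (h1 - h2) / 2

/-- **Order raising**: `G₀(x, w + i) = G₁(x, w) - (iw/x) G₀(x, w)`, i.e.
`K_{ν-1}(x) = -K_ν'(x) - (ν/x) K_ν(x)` for `ν = iw`. [folklore] -/
theorem polyaG_zero_add_I {x : ℝ} (hx : 0 < x) (w : ℂ) :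
    polyaG 0 x (w + I) = polyaG 1 x w - (I * w / x) * polyaG 0 x w := by
  have h1 := polyaG_zero_add_I_add_polyaG_zero_sub_I hx w
  have h2 := polyaG_zero_add_I_sub_polyaG_zero_sub_I hx w
  linear_combination (h1 + h2) / 2

end Polya1926

end Literature.Analysis.Complex

/-! ### The Bessel mode `besselMode κ w y = √y G₀(κy, w)` -/

namespace Literature.NumberTheory.Automorphic

open Literature.Analysis.Complex Literature.Analysis.Complex.Polya1926

/-- **Order shift of the Bessel mode through its derivative**:
`besselMode κ (w - i) y = ((1/2 + iw)/(κy)) besselMode κ w y - κ⁻¹ besselMode₁ κ w y` (`κ, y > 0`).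
[folklore] -/
theorem besselMode_sub_I {κ : ℝ} (hκ : 0 < κ) (w : ℂ) {y : ℝ} (hy : 0 < y) :
    besselMode κ (w - I) y = ((1 / 2 + I * w) / (κ * y)) * besselMode κ w y - (1 / κ) * besselMode₁ κ w y := by
  have hS0 : (Real.sqrt y : ℂ) ≠ 0 := by exact_mod_cast (Real.sqrt_pos.mpr hy).ne'
  have hS2 : (Real.sqrt y : ℂ) ^ 2 = (y : ℂ) := by rw [← Complex.ofReal_pow, Real.sq_sqrt hy.le]
  have hy0 : (y : ℂ) ≠ 0 := Complex.ofReal_ne_zero.mpr hy.ne'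
  have hκ0 : (κ : ℂ) ≠ 0 := Complex.ofReal_ne_zero.mpr hκ.ne'
  rw [besselMode, besselMode, besselMode₁, polyaG_zero_sub_I (mul_pos hκ hy) w]
  push_cast
  field_simp
  rw [hS2] at *
  ring_nf

/-- **Order shift of the Bessel mode through its derivative**:
`besselMode κ (w + i) y = ((1/2 - iw)/(κy)) besselMode κ w y - κ⁻¹ besselMode₁ κ w y` (`κ, y > 0`).
[folklore] -/
theorem besselMode_add_I {κ : ℝ} (hκ : 0 < κ) (w : ℂ) {y : ℝ} (hy : 0 < y) :
    besselMode κ (w + I) y = ((1 / 2 - I * w) / (κ * y)) * besselMode κ w y - (1 / κ) * besselMode₁ κ w y := by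
  have hS0 : (Real.sqrt y : ℂ) ≠ 0 := by exact_mod_cast (Real.sqrt_pos.mpr hy).ne'
  have hS2 : (Real.sqrt y : ℂ) ^ 2 = (y : ℂ) := by rw [← Complex.ofReal_pow, Real.sq_sqrt hy.le]
  have hy0 : (y : ℂ) ≠ 0 := Complex.ofReal_ne_zero.mpr hy.ne'
  have hκ0 : (κ : ℂ) ≠ 0 := Complex.ofReal_ne_zero.mpr hκ.ne'
  rw [besselMode, besselMode, besselMode₁, polyaG_zero_add_I (mul_pos hκ hy) w]
  push_cast
  field_simp
  rw [hS2] at *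
  ring_nf

end Literature.NumberTheory.Automorphic
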